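import Literature.Computability.Complexity.ThetaFWMachineStep
import Literature.Computability.Complexity.KarpCliqueNP
import HarnessLib

/-!
# The Frank–Wolfe machine for `ϑ`, III: parsing the graph code, the constants, the output, and the machine

Topic `Computability/Complexity`; completes `ThetaFWMachineTables.lean` / `ThetaFWMachineStep.lean`
(`coreF`: the clocked saturated Frank–Wolfe iteration `ThetaFW.iterCap W T` on matrix codes) towards
the discharge of `Literature.Computability.Complexity.GLS1981_thetaApprox_unary_FP`
(`ThetaApproximationProofs.lean`). On the input `inp = ⟨⟨bin n, adjacency bits⟩, 1ᵐ⟩` of that fact: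

* the yardstick `yardF inp = 1^{Q(|inp|)}` (`budgetPoly = 2³¹ (X+1)³⁹`, `Plumb.polyFn`), the headers
  `bin n` (`nnF`), the `n²` adjacency bits (`bitsF`), `bin m` (`mmF`, the length of the unary field);
* the constants of `ThetaFW` as numerals: `cMF, c0F, cqF, ckF, crF, cTF, cpF` (`⌊log₂ v⌋ + 1` is
  `(|bin v| ∸ 1) + 1`, `logSuccF_apply`), `p2F = bin 2ᵖ` (`2ᵖ = ⟦1ᵖ⟧ + 1`), and the scalar record
  `scF inp = scCode n m`;
* the tables: `maskF inp = maskCode H` (entry `(i,j)`: the bit at position `i n + j` of the adjacency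
  field, read with `bitAtFn` at the unary position `binToUnaryFn ⟨bits, bin (i n + j)⟩`, and the test
  `[1ⁱ = 1ʲ]`), `idF inp = matCode 1`, `onesMF inp = matCode (of 1)`, all by `tab2F`;
* the run `finalF inp = matCode (iterCap W T)` (`coreF` on the assembled record) and the output
  `thetaMachineF inp = bin (thetaZCap W).toNat` through the Frobenius sums `τ = ⟨1, N⟩`, `Σ Nᵢⱼ = ⟨J, N⟩`,
  `Σ_E Nᵢⱼ² = ⟨E ⊙ N, N⟩`, the numerator `outNum`, and `⌈outNum / 8τ²⌉ = -((-outNum)/(8τ²))`;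
* **`thetaMachineF ∈ FP`** and **`thetaMachineF_encode`**: on `⟨code of ⟨n, H⟩, 1ᵐ⟩` the machine returns
  `bin (ThetaFW.thetaZCap n m H W).toNat`, `W = Q(|inp|)`, whenever `n, r, T, p ≤ W`.

## References

* M. Grötschel, L. Lovász, A. Schrijver, Combinatorica 1 (1981) 169–197, §6 [GrotschelLovaszSchrijver1981].
* M. Jaggi, arXiv:1108.1170 (2011), Alg. 6, Thm. 17 [Jaggi2011].
* S. Arora, B. Barak, *Computational Complexity: A Modern Approach*, CUP 2009, §1.3, §0.1 [AroraBarak2009].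
-/

noncomputable section

namespace Literature.Computability.Complexity

namespace ThetaFWMachine

open _root_.Computability Polynomial Brick Literature.Algebra.EuclideanLattices
  Literature.Algebra.EuclideanLattices.LLLMachine Literature.Combinatorics.SimpleGraph
  Literature.Combinatorics.SimpleGraph.ThetaFW Matrix

variable {n : ℕ}

/-! ### The input, the yardstick and the headers -/

/-- The input string of the fact: `⟨⟨bin n, adjacency bits of H⟩, 1ᵐ⟩`. [folklore] -/
def inputCode (m : ℕ) (H : SimpleGraph (Fin n)) : List Bool :=
  boolPair (boolPair (encodeNat n) (CliqueNP.adjBits n H)) (unaryEncodeNat m)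

/-- The input string is the one of `GLS1981_thetaApprox_unary_FP`. [folklore] -/
theorem inputCode_eq (m : ℕ) (H : SimpleGraph (Fin n)) :
    inputCode m H = boolPair (encodingGraph.encode ⟨n, H⟩) (unaryEncodeNat m) := by
  rw [inputCode, encodingGraph_encode, CliqueNP.encodingGraphFin_encode_eq]

/-- **The budget polynomial** `Q = 2³¹ (X + 1)³⁹`. [folklore] -/
def budgetPoly : Polynomial ℕ := 2 ^ 31 * (X + 1) ^ 39

/-- Evaluation of the budget polynomial. [folklore] -/
@[simp] theorem budgetPoly_eval (L : ℕ) : budgetPoly.eval L = 2 ^ 31 * (L + 1) ^ 39 := by simp [budgetPoly]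

/-- **The yardstick** `1^{Q(|inp|)}`. [folklore] -/
def yardF : List Bool → List Bool := Plumb.polyFn budgetPoly

/-- `yardF ∈ FP`. [folklore] -/
theorem yardF_mem_FP : yardF ∈ FP := Plumb.polyFn_mem_FP _

/-- The width of the run on an input. [folklore] -/
def width (inp : List Bool) : ℕ := budgetPoly.eval inp.length

/-- `yardF inp = 1^{width inp}`. [folklore] -/
@[simp] theorem yardF_apply (inp : List Bool) : yardF inp = ones (width inp) := by simp [yardF, width]

/-- `|yardF inp| = width inp`. [folklore] -/
theorem length_yardF (inp : List Bool) : (yardF inp).length = width inp := by simp [ones]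

/-- The header `bin n`. [folklore] -/
def nnF : List Bool → List Bool := fstF ∘ fstF
/-- The adjacency bits. [folklore] -/
def bitsF : List Bool → List Bool := sndF ∘ fstF
/-- The accuracy parameter `bin m` (the length of the unary field, in binary). [folklore] -/
def mmF : List Bool → List Bool := lenBinF ∘ sndF

/-- `nnF ∈ FP`. [folklore] -/
theorem nnF_mem_FP : nnF ∈ FP := comp_mem_FP fstF_mem_FP fstF_mem_FP
/-- `bitsF ∈ FP`. [folklore] -/
theorem bitsF_mem_FP : bitsF ∈ FP := comp_mem_FP sndF_mem_FP fstF_mem_FP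
/-- `mmF ∈ FP`. [folklore] -/
theorem mmF_mem_FP : mmF ∈ FP := comp_mem_FP lenBinF_mem_FP sndF_mem_FP

section Headers
variable (m : ℕ) (H : SimpleGraph (Fin n))
/-- `nnF` on the input. [folklore] -/
@[simp] theorem nnF_input : nnF (inputCode m H) = encodeNat n := by simp [nnF, inputCode]
/-- `bitsF` on the input. [folklore] -/
@[simp] theorem bitsF_input : bitsF (inputCode m H) = CliqueNP.adjBits n H := by simp [bitsF, inputCode]
/-- `mmF` on the input. [folklore] -/
@[simp] theorem mmF_input : mmF (inputCode m H) = encodeNat m := by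
  have h : (unaryEncodeNat m).length = m := unary_decode_encode_nat m
  simp [mmF, inputCode, h]
end Headers

/-! ### The constants as numerals -/

/-- The `k`-th power of a numeral-valued function: `npowF k f inp = bin (⟦f inp⟧ᵏ)`. [folklore] -/
def npowF : ℕ → (List Bool → List Bool) → (List Bool → List Bool)
  | 0, _ => fun _ => encodeNat 1
  | k + 1, f => prodFn ∘ fanoutFn f (npowF k f)

/-- `npowF k f ∈ FP`. [folklore] -/
theorem npowF_mem_FP {f : List Bool → List Bool} (hf : f ∈ FP) : ∀ k, npowF k f ∈ FP
  | 0 => const_mem_FP _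
  | k + 1 => comp_mem_FP prodFn_mem_FP (fanoutFn_mem_FP hf (npowF_mem_FP hf k))

/-- Value of `npowF`. [folklore] -/
@[simp] theorem npowF_apply (f : List Bool → List Bool) (inp : List Bool) : ∀ k, npowF k f inp = encodeNat (bitsToNat (f inp) ^ k)
  | 0 => rfl
  | k + 1 => by rw [npowF, Function.comp_apply, fanoutFn_apply, prodFn_boolPair, npowF_apply f inp k, bitsToNat_encodeNat, pow_succ']

/-- `bin (n⁶ m)` (`cM`). [folklore] -/
def cMF : List Bool → List Bool := prodFn ∘ fanoutFn (npowF 6 nnF) mmF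
/-- `bin (n (1 + 2 cM))` (`c₀`). [folklore] -/
def c0F : List Bool → List Bool :=
  prodFn ∘ fanoutFn nnF (addFn ∘ fanoutFn (fun _ => encodeNat 1) (prodFn ∘ fanoutFn (fun _ => encodeNat 2) cMF))
/-- `bin (32 m c₀)` (`q`). [folklore] -/
def cqF : List Bool → List Bool := prodFn ∘ fanoutFn (prodFn ∘ fanoutFn (fun _ => encodeNat 32) mmF) c0F
/-- `u ↦ bin ((|u| ∸ 1) + 1)`: on `u = bin v` this is `bin (⌊log₂ v⌋ + 1)`. [folklore] -/
def logSuccF : List Bool → List Bool := addFn ∘ fanoutFn (subFn ∘ fanoutFn lenBinF (fun _ => encodeNat 1)) (fun _ => encodeNat 1)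
/-- `bin (⌊log₂ (n q)⌋ + 1)` (`k`). [folklore] -/
def ckF : List Bool → List Bool := logSuccF ∘ prodFn ∘ fanoutFn nnF cqF
/-- `bin (q k)` (`r`). [folklore] -/
def crF : List Bool → List Bool := prodFn ∘ fanoutFn cqF ckF
/-- `bin (512 n⁶ m²)` (`T`). [folklore] -/
def cTF : List Bool → List Bool := prodFn ∘ fanoutFn (prodFn ∘ fanoutFn (fun _ => encodeNat 512) (npowF 6 nnF)) (npowF 2 mmF)
/-- `bin (⌊log₂ (2¹⁵ n¹⁶ m⁴)⌋ + 1)` (`p`). [folklore] -/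
def cpF : List Bool → List Bool :=
  logSuccF ∘ prodFn ∘ fanoutFn (prodFn ∘ fanoutFn (fun _ => encodeNat (2 ^ 15)) (npowF 16 nnF)) (npowF 4 mmF)
/-- `bin 2ᵖ = bin (⟦1ᵖ⟧ + 1)`, the unary `1ᵖ` read off the yardstick (`p ≤ W`). [folklore] -/
def p2F : List Bool → List Bool := addFn ∘ fanoutFn (binToUnaryFn ∘ fanoutFn yardF cpF) (fun _ => encodeNat 1)

/-- `cMF ∈ FP`. [folklore] -/
theorem cMF_mem_FP : cMF ∈ FP := comp_mem_FP prodFn_mem_FP (fanoutFn_mem_FP (npowF_mem_FP nnF_mem_FP 6) mmF_mem_FP)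
/-- `c0F ∈ FP`. [folklore] -/
theorem c0F_mem_FP : c0F ∈ FP :=
  comp_mem_FP prodFn_mem_FP (fanoutFn_mem_FP nnF_mem_FP (comp_mem_FP addFn_mem_FP (fanoutFn_mem_FP (const_mem_FP _)
    (comp_mem_FP prodFn_mem_FP (fanoutFn_mem_FP (const_mem_FP _) cMF_mem_FP)))))
/-- `cqF ∈ FP`. [folklore] -/
theorem cqF_mem_FP : cqF ∈ FP :=
  comp_mem_FP prodFn_mem_FP (fanoutFn_mem_FP (comp_mem_FP prodFn_mem_FP (fanoutFn_mem_FP (const_mem_FP _) mmF_mem_FP)) c0F_mem_FP)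
/-- `logSuccF ∈ FP`. [folklore] -/
theorem logSuccF_mem_FP : logSuccF ∈ FP :=
  comp_mem_FP addFn_mem_FP (fanoutFn_mem_FP (comp_mem_FP subFn_mem_FP (fanoutFn_mem_FP lenBinF_mem_FP (const_mem_FP _))) (const_mem_FP _))
/-- `ckF ∈ FP`. [folklore] -/
theorem ckF_mem_FP : ckF ∈ FP := comp_mem_FP logSuccF_mem_FP (comp_mem_FP prodFn_mem_FP (fanoutFn_mem_FP nnF_mem_FP cqF_mem_FP))
/-- `crF ∈ FP`. [folklore] -/
theorem crF_mem_FP : crF ∈ FP := comp_mem_FP prodFn_mem_FP (fanoutFn_mem_FP cqF_mem_FP ckF_mem_FP)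
/-- `cTF ∈ FP`. [folklore] -/
theorem cTF_mem_FP : cTF ∈ FP :=
  comp_mem_FP prodFn_mem_FP (fanoutFn_mem_FP (comp_mem_FP prodFn_mem_FP (fanoutFn_mem_FP (const_mem_FP _) (npowF_mem_FP nnF_mem_FP 6)))
    (npowF_mem_FP mmF_mem_FP 2))
/-- `cpF ∈ FP`. [folklore] -/
theorem cpF_mem_FP : cpF ∈ FP :=
  comp_mem_FP logSuccF_mem_FP (comp_mem_FP prodFn_mem_FP (fanoutFn_mem_FP
    (comp_mem_FP prodFn_mem_FP (fanoutFn_mem_FP (const_mem_FP _) (npowF_mem_FP nnF_mem_FP 16))) (npowF_mem_FP mmF_mem_FP 4)))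
/-- `p2F ∈ FP`. [folklore] -/
theorem p2F_mem_FP : p2F ∈ FP :=
  comp_mem_FP addFn_mem_FP (fanoutFn_mem_FP (comp_mem_FP binToUnaryFn_mem_FP (fanoutFn_mem_FP yardF_mem_FP cpF_mem_FP)) (const_mem_FP _))

/-- `|bin v| = ⌊log₂ v⌋ + 1` after the correction `(· ∸ 1) + 1` (which also covers `v = 0`). [folklore] -/
theorem size_sub_one_add_one (v : ℕ) : (encodeNat v).length - 1 + 1 = Nat.log 2 v + 1 := by
  rw [TM2Pass.length_encodeNat_eq_size]
  rcases Nat.eq_zero_or_pos v with rfl | hv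
  · simp
  · have h1 : v.size ≤ Nat.log 2 v + 1 := Nat.size_le.2 (Nat.lt_pow_succ_log_self one_lt_two v)
    have h2 : Nat.log 2 v < v.size := Nat.lt_size.2 (Nat.pow_log_le_self 2 hv.ne')
    omega

/-- Value of `logSuccF` on a canonical numeral. [folklore] -/
theorem logSuccF_apply (v : ℕ) : logSuccF (encodeNat v) = encodeNat (Nat.log 2 v + 1) := by
  simp [logSuccF, size_sub_one_add_one]

section Constants
variable (m : ℕ) (H : SimpleGraph (Fin n))

/-- `cMF` on the input. [folklore] -/
@[simp] theorem cMF_input : cMF (inputCode m H) = encodeNat (cM n m) := by simp [cMF, cM]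
/-- `c0F` on the input. [folklore] -/
@[simp] theorem c0F_input : c0F (inputCode m H) = encodeNat (c0 n m) := by simp [c0F, c0]
/-- `cqF` on the input. [folklore] -/
@[simp] theorem cqF_input : cqF (inputCode m H) = encodeNat (cq n m) := by simp [cqF, cq, mul_assoc]
/-- `ckF` on the input. [folklore] -/
@[simp] theorem ckF_input : ckF (inputCode m H) = encodeNat (ck n m) := by
  simp only [ckF, Function.comp_apply, fanoutFn_apply, nnF_input, cqF_input, prodFn_boolPair, bitsToNat_encodeNat]
  rw [logSuccF_apply, ck]
/-- `crF` on the input. [folklore] -/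
@[simp] theorem crF_input : crF (inputCode m H) = encodeNat (cr n m) := by simp [crF, cr]
/-- `cTF` on the input. [folklore] -/
@[simp] theorem cTF_input : cTF (inputCode m H) = encodeNat (cT n m) := by simp [cTF, cT]
/-- `cpF` on the input. [folklore] -/
@[simp] theorem cpF_input : cpF (inputCode m H) = encodeNat (cp n m) := by
  simp only [cpF, Function.comp_apply, fanoutFn_apply, nnF_input, mmF_input, npowF_apply, prodFn_boolPair, bitsToNat_encodeNat]
  rw [logSuccF_apply, cp]
/-- `p2F` on the input (`p ≤ W`). [folklore] -/
theorem p2F_input (hp : cp n m ≤ width (inputCode m H)) : p2F (inputCode m H) = encodeNat (2 ^ cp n m) := by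
  have h2 : 1 ≤ 2 ^ cp n m := Nat.one_le_two_pow
  simp only [p2F, Function.comp_apply, fanoutFn_apply, yardF_apply, cpF_input, binToUnaryFn_boolPair, bitsToNat_encodeNat,
    addFn_boolPair]
  have hl : (ones (width (inputCode m H))).length = width (inputCode m H) := by simp [ones]
  rw [hl, Nat.min_eq_left hp, bitsToNat_ones]
  congr 1; omega

end Constants

/-- **The scalar record** of the input. [folklore] -/
def scF : List Bool → List Bool :=
  fanoutFn cTF (fanoutFn crF (fanoutFn (natToZF ∘ prodFn ∘ fanoutFn (fun _ => encodeNat 2) cMF)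
    (fanoutFn (natToZF ∘ c0F) (fanoutFn (natToZF ∘ p2F) (natToZF ∘ nnF)))))

/-- `scF ∈ FP`. [folklore] -/
theorem scF_mem_FP : scF ∈ FP :=
  fanoutFn_mem_FP cTF_mem_FP (fanoutFn_mem_FP crF_mem_FP (fanoutFn_mem_FP
    (comp_mem_FP natToZF_mem_FP (comp_mem_FP prodFn_mem_FP (fanoutFn_mem_FP (const_mem_FP _) cMF_mem_FP)))
    (fanoutFn_mem_FP (comp_mem_FP natToZF_mem_FP c0F_mem_FP) (fanoutFn_mem_FP (comp_mem_FP natToZF_mem_FP p2F_mem_FP)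
      (comp_mem_FP natToZF_mem_FP nnF_mem_FP)))))

/-- **`scF` on the input is `scCode n m`** (`p ≤ W`). [folklore] -/
theorem scF_input (m : ℕ) (H : SimpleGraph (Fin n)) (hp : cp n m ≤ width (inputCode m H)) : scF (inputCode m H) = scCode n m := by
  simp only [scF, fanoutFn_apply, Function.comp_apply, cTF_input, crF_input, cMF_input, c0F_input, p2F_input m H hp, nnF_input,
    prodFn_boolPair, bitsToNat_encodeNat, natToZF_encodeNat, scCode]
  push_cast
  rfl

/-! ### The tables: mask, identity, all-ones -/

/-- The edge entry on `⟨x, ⟨⟨nn, bits⟩, ⟨1ⁱ, 1ʲ⟩⟩⟩`: the canonical code of the bit of `bits` at position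
`i n + j` (read at the unary position `binToUnaryFn ⟨bits, bin (i n + j)⟩`). [cite: AroraBarak2009, §0.1 (adjacency matrix)] -/
def eItem : List Bool → List Bool :=
  zcanonF ∘ fanoutFn
    (bitAtFn ∘ fanoutFn
      (binToUnaryFn ∘ fanoutFn (sndF ∘ nthF 1)
        (addFn ∘ fanoutFn (prodFn ∘ fanoutFn (lenBinF ∘ nthF 2) (fstF ∘ nthF 1)) (lenBinF ∘ sndPow 2)))
      (sndF ∘ nthF 1))
    (fun _ => [])

/-- The diagonal entry on `⟨x, ⟨p, ⟨1ⁱ, 1ʲ⟩⟩⟩`: the canonical code of `[1ⁱ = 1ʲ]`. [folklore] -/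
def dItem : List Bool → List Bool := zcanonF ∘ fanoutFn (eqPairFn ∘ fanoutFn (nthF 2) (sndPow 2)) (fun _ => [])

/-- The mask entry: `⟨eItem, dItem⟩`. [folklore] -/
def kItem : List Bool → List Bool := fanoutFn eItem dItem

/-- The all-ones entry: `dpEnc 1`. [folklore] -/
def jItem : List Bool → List Bool := fun _ => dpEnc 1

/-- `eItem ∈ FP`. [folklore] -/
theorem eItem_mem_FP : eItem ∈ FP :=
  comp_mem_FP zcanonF_mem_FP (fanoutFn_mem_FP
    (comp_mem_FP bitAtFn_mem_FP (fanoutFn_mem_FP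
      (comp_mem_FP binToUnaryFn_mem_FP (fanoutFn_mem_FP (comp_mem_FP sndF_mem_FP (nthF_mem_FP 1))
        (comp_mem_FP addFn_mem_FP (fanoutFn_mem_FP
          (comp_mem_FP prodFn_mem_FP (fanoutFn_mem_FP (comp_mem_FP lenBinF_mem_FP (nthF_mem_FP 2)) (comp_mem_FP fstF_mem_FP (nthF_mem_FP 1))))
          (comp_mem_FP lenBinF_mem_FP (sndPow_mem_FP 2))))))
      (comp_mem_FP sndF_mem_FP (nthF_mem_FP 1))))
    (const_mem_FP _))
/-- `dItem ∈ FP`. [folklore] -/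
theorem dItem_mem_FP : dItem ∈ FP :=
  comp_mem_FP zcanonF_mem_FP (fanoutFn_mem_FP (comp_mem_FP eqPairFn_mem_FP (fanoutFn_mem_FP (nthF_mem_FP 2) (sndPow_mem_FP 2))) (const_mem_FP _))
/-- `kItem ∈ FP`. [folklore] -/
theorem kItem_mem_FP : kItem ∈ FP := fanoutFn_mem_FP eItem_mem_FP dItem_mem_FP
/-- `jItem ∈ FP`. [folklore] -/
theorem jItem_mem_FP : jItem ∈ FP := const_mem_FP _

/-- A canonical code of a pair `⟨c, ε⟩` with `|c| ≤ 1` is short: `≤ 10`. [folklore] -/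
theorem length_zcanonF_pair_nil_le (c : List Bool) (hc : c.length ≤ 1) : (zcanonF (boolPair c [])).length ≤ 10 := by
  rw [zcanonF_eq]
  have h1 := length_dpEnc_le_two_mul (ival (boolPair c []))
  have h2 := length_encodeNat_natAbs_ival_le (boolPair c [])
  rw [zlen_boolPair] at h2
  simp only [List.length_nil, add_zero] at h2
  omega

/-- `eItem` is short on every input: `≤ 10`. [folklore] -/
theorem length_eItem_le (z : List Bool) : (eItem z).length ≤ 10 := by
  rw [eItem, Function.comp_apply, fanoutFn_apply]
  refine length_zcanonF_pair_nil_le _ ?_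
  rw [Function.comp_apply, fanoutFn_apply, bitAtFn_boolPair]
  exact (List.length_take_le _ _)

/-- `dItem` is short on every input: `≤ 10`. [folklore] -/
theorem length_dItem_le (z : List Bool) : (dItem z).length ≤ 10 := by
  rw [dItem, Function.comp_apply, fanoutFn_apply]
  refine length_zcanonF_pair_nil_le _ ?_
  show (eqPairFn (fanoutFn (nthF 2) (sndPow 2) z)).length ≤ 1
  rcases eqPairFn_eq_or (fanoutFn (nthF 2) (sndPow 2) z) with h | h <;> rw [h] <;> simp

/-- `kItem` is absolutely bounded: `≤ 32`. [folklore] -/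
theorem length_kItem_le (x p a b : List Bool) : (kItem (boolPair x (boolPair p (boolPair a b)))).length ≤ (32 : Polynomial ℕ).eval x.length := by
  have h1 := length_eItem_le (boolPair x (boolPair p (boolPair a b)))
  have h2 := length_dItem_le (boolPair x (boolPair p (boolPair a b)))
  rw [kItem, fanoutFn_apply, length_boolPair, eval_ofNat]
  omega

/-- `dItem` is absolutely bounded (in the item shape). [folklore] -/
theorem length_dItem_le' (x p a b : List Bool) : (dItem (boolPair x (boolPair p (boolPair a b)))).length ≤ (10 : Polynomial ℕ).eval x.length := by
  rw [eval_ofNat]; exact length_dItem_le _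

/-- `jItem` is absolutely bounded. [folklore] -/
theorem length_jItem_le (x p a b : List Bool) : (jItem (boolPair x (boolPair p (boolPair a b)))).length ≤ (4 : Polynomial ℕ).eval x.length := by
  rw [eval_ofNat, show jItem (boolPair x (boolPair p (boolPair a b))) = dpEnc 1 from rfl]
  have h := length_dpEnc_le_two_mul 1
  have h1 : (encodeNat (1 : ℤ).natAbs).length = 1 := by rw [TM2Pass.length_encodeNat_eq_size]; rfl
  omega

/-- The bit string `[b]` has value `[b]`. [folklore] -/
theorem ival_singleton_nil (b : Bool) : ival (boolPair [b] []) = if b then 1 else 0 := by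
  cases b <;> simp

/-- **Semantics of `eItem`**: the edge indicator. [cite: AroraBarak2009, §0.1 (adjacency matrix)] -/
theorem eItem_apply (x : List Bool) (H : SimpleGraph (Fin n)) [DecidableRel H.Adj] (i j : Fin n)
    (hdec : ∀ i j : Fin n, (CliqueNP.adjBits n H).getD ((i : ℕ) * n + j) false = decide (H.Adj i j)) :
    eItem (boolPair x (boolPair (boolPair (encodeNat n) (CliqueNP.adjBits n H)) (boolPair (ones i) (ones j)))) = dpEnc (eInd H i j) := by
  have hlt : (i : ℕ) * n + j < (CliqueNP.adjBits n H).length := by rw [CliqueNP.length_adjBits]; exact CliqueNP.flat_lt i j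
  have hlen : (ones ((i : ℕ) * n + j)).length = (i : ℕ) * n + j := by simp [ones]
  have htake : ((CliqueNP.adjBits n H).drop ((i : ℕ) * n + j)).take 1 = [(CliqueNP.adjBits n H).getD ((i : ℕ) * n + j) false] := by
    rw [List.take_one_drop_eq_of_lt_length hlt]
    simp [List.getD_eq_getElem?_getD, List.getElem?_eq_getElem hlt]
  simp only [eItem, Function.comp_apply, fanoutFn_apply, nthF_succ_boolPair, nthF_zero_boolPair, sndPow_succ_boolPair, sndPow_zero,
    sndF_boolPair, fstF_boolPair, lenBinF_apply, prodFn_boolPair, addFn_boolPair, bitsToNat_encodeNat, binToUnaryFn_boolPair]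
  rw [show (ones (i : ℕ)).length * n + (ones (j : ℕ)).length = (i : ℕ) * n + j by simp [ones], Nat.min_eq_left hlt.le,
    bitAtFn_boolPair, hlen, htake, hdec i j, zcanonF_eq, ival_singleton_nil, eInd]
  by_cases h : H.Adj i j <;> simp [h]

/-- **Semantics of `dItem`**: the diagonal indicator. [folklore] -/
theorem dItem_apply (x p : List Bool) (i j : Fin n) :
    dItem (boolPair x (boolPair p (boolPair (ones i) (ones j)))) = dpEnc (dInd i j) := by
  simp only [dItem, Function.comp_apply, fanoutFn_apply, nthF_succ_boolPair, nthF_zero_boolPair, sndPow_succ_boolPair, sndPow_zero,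
    sndF_boolPair, eqPairFn_boolPair, zcanonF_eq, ival_singleton_nil, dInd]
  by_cases h : i = j
  · subst h; simp
  · have h' : ones (i : ℕ) ≠ ones (j : ℕ) := fun e => h (Fin.ext (by simpa [ones] using congrArg List.length e))
    simp [h, h']

/-- The record the tables are built from: `⟨x, ⟨nn, ⟨nn, bits⟩⟩⟩`. [folklore] -/
def tabArgF : List Bool → List Bool := fanoutFn yardF (fanoutFn nnF (fanoutFn nnF bitsF))

/-- `tabArgF ∈ FP`. [folklore] -/
theorem tabArgF_mem_FP : tabArgF ∈ FP := fanoutFn_mem_FP yardF_mem_FP (fanoutFn_mem_FP nnF_mem_FP (fanoutFn_mem_FP nnF_mem_FP bitsF_mem_FP))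

/-- **The mask table of the input.** [folklore] -/
def maskF : List Bool → List Bool := tab2F kItem ∘ tabArgF
/-- **The identity matrix code** `matCode 1`. [folklore] -/
def idF : List Bool → List Bool := tab2F dItem ∘ tabArgF
/-- **The all-ones matrix code.** [folklore] -/
def onesMF : List Bool → List Bool := tab2F jItem ∘ tabArgF

/-- `maskF ∈ FP`. [folklore] -/
theorem maskF_mem_FP : maskF ∈ FP := comp_mem_FP (tab2F_mem_FP kItem_mem_FP length_kItem_le) tabArgF_mem_FP
/-- `idF ∈ FP`. [folklore] -/
theorem idF_mem_FP : idF ∈ FP := comp_mem_FP (tab2F_mem_FP dItem_mem_FP length_dItem_le') tabArgF_mem_FP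
/-- `onesMF ∈ FP`. [folklore] -/
theorem onesMF_mem_FP : onesMF ∈ FP := comp_mem_FP (tab2F_mem_FP jItem_mem_FP length_jItem_le) tabArgF_mem_FP

section Tables
variable (m : ℕ) (H : SimpleGraph (Fin n))

/-- `tabArgF` on the input. [folklore] -/
theorem tabArgF_input : tabArgF (inputCode m H) =
    boolPair (ones (width (inputCode m H))) (boolPair (encodeNat n) (boolPair (encodeNat n) (CliqueNP.adjBits n H))) := by
  simp [tabArgF]

/-- **`maskF` on the input is the mask table** (`n ≤ W`, adjacency bits decided as `H.Adj`). [cite: AroraBarak2009, §0.1 (adjacency matrix)] -/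
theorem maskF_input [DecidableRel H.Adj] (hn : n ≤ width (inputCode m H))
    (hdec : ∀ i j : Fin n, (CliqueNP.adjBits n H).getD ((i : ℕ) * n + j) false = decide (H.Adj i j)) :
    maskF (inputCode m H) = maskCode H := by
  rw [maskF, Function.comp_apply, tabArgF_input, tab2F_apply _ _ (by simpa [ones] using hn), maskCode]
  refine congrArg tabCode (funext fun i => funext fun j => ?_)
  rw [kItem, fanoutFn_apply, eItem_apply _ H i j hdec, dItem_apply]

/-- **`idF` on the input is `matCode 1`** (`n ≤ W`). [folklore] -/
theorem idF_input (hn : n ≤ width (inputCode m H)) : idF (inputCode m H) = matCode (1 : Matrix (Fin n) (Fin n) ℤ) := by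
  rw [idF, Function.comp_apply, tabArgF_input, tab2F_apply _ _ (by simpa [ones] using hn), matCode_one]
  refine congrArg tabCode (funext fun i => funext fun j => ?_)
  rw [dItem_apply]

/-- **`onesMF` on the input is the all-ones matrix code** (`n ≤ W`). [folklore] -/
theorem onesMF_input (hn : n ≤ width (inputCode m H)) :
    onesMF (inputCode m H) = matCode (Matrix.of fun _ _ : Fin n => (1 : ℤ)) := by
  rw [onesMF, Function.comp_apply, tabArgF_input, tab2F_apply _ _ (by simpa [ones] using hn), matCode_eq_tabCode]
  rfl

end Tables


/-! ### The run -/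

/-- **The parameter record** of the input: `⟨nn, ⟨mask, ⟨identity, scalars⟩⟩⟩`. [folklore] -/
def prmF : List Bool → List Bool := fanoutFn nnF (fanoutFn maskF (fanoutFn idF scF))

/-- `prmF ∈ FP`. [folklore] -/
theorem prmF_mem_FP : prmF ∈ FP := fanoutFn_mem_FP nnF_mem_FP (fanoutFn_mem_FP maskF_mem_FP (fanoutFn_mem_FP idF_mem_FP scF_mem_FP))

/-- The record the core runs on: `⟨x, ⟨bin T, ⟨prm, identity⟩⟩⟩`. [folklore] -/
def coreInF : List Bool → List Bool := fanoutFn yardF (fanoutFn cTF (fanoutFn prmF idF))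

/-- `coreInF ∈ FP`. [folklore] -/
theorem coreInF_mem_FP : coreInF ∈ FP :=
  fanoutFn_mem_FP yardF_mem_FP (fanoutFn_mem_FP cTF_mem_FP (fanoutFn_mem_FP prmF_mem_FP idF_mem_FP))

/-- **The final matrix** `N_T`: the core on the assembled record. [cite: Jaggi2011, Alg. 6 (chunk p0020)] -/
def finalF : List Bool → List Bool := coreF ∘ coreInF

/-- `finalF ∈ FP`. [folklore] -/
theorem finalF_mem_FP : finalF ∈ FP := comp_mem_FP coreF_mem_FP coreInF_mem_FP

section Run

variable (m : ℕ) (H : SimpleGraph (Fin n)) [DecidableRel H.Adj]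

/-- The side conditions of the run on the input of `(n, H, m)`: the width dominates `n, r, T, p`, and the
adjacency bits are decided as `H.Adj`. [folklore] -/
structure RunHyp : Prop where
  /-- `n ≤ W` -/
  hn : n ≤ width (inputCode m H)
  /-- `r ≤ W` -/
  hr : cr n m ≤ width (inputCode m H)
  /-- `T ≤ W` -/
  hT : cT n m ≤ width (inputCode m H)
  /-- `p ≤ W` -/
  hp : cp n m ≤ width (inputCode m H)
  /-- the bits of the code are the adjacencies -/
  hdec : ∀ i j : Fin n, (CliqueNP.adjBits n H).getD ((i : ℕ) * n + j) false = decide (H.Adj i j)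

variable {m H}

omit [DecidableRel H.Adj] in
/-- The yardstick has length `W`. [folklore] -/
theorem length_ones_width : (ones (width (inputCode m H))).length = width (inputCode m H) := by simp [ones]

/-- **`prmF` on the input is `prmCode`.** [folklore] -/
theorem prmF_input (h : RunHyp m H) : prmF (inputCode m H) = prmCode m H := by
  rw [prmF, fanoutFn_apply, fanoutFn_apply, fanoutFn_apply, nnF_input, maskF_input m H h.hn h.hdec, idF_input m H h.hn,
    scF_input m H h.hp, prmCode]

/-- **`finalF` on the input is the code of `iterCap W T`.** [cite: Jaggi2011, Alg. 6 (chunk p0020)] -/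
theorem finalF_input (h : RunHyp m H) :
    finalF (inputCode m H) = matCode (iterCap n m H (width (inputCode m H)) (cT n m)) := by
  have hc := coreF_apply (ones (width (inputCode m H))) (m := m) (by rw [length_ones_width]; exact h.hn)
    (by rw [length_ones_width]; exact h.hr) (by rw [length_ones_width]; exact h.hT) H
  rw [length_ones_width] at hc
  rw [finalF, Function.comp_apply, coreInF, fanoutFn_apply, fanoutFn_apply, fanoutFn_apply, yardF_apply, cTF_input, prmF_input h,
    idF_input m H h.hn, hc]

end Run

/-! ### The output -/

/-- `τ = ⟨1, N_T⟩`. [folklore] -/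
def tauOF : List Bool → List Bool := frobF ∘ fanoutFn yardF (fanoutFn nnF (fanoutFn idF finalF))
/-- `Σᵢⱼ Nᵢⱼ = ⟨J, N_T⟩`. [folklore] -/
def eSF : List Bool → List Bool := frobF ∘ fanoutFn yardF (fanoutFn nnF (fanoutFn onesMF finalF))
/-- The edge-masked matrix `E ⊙ N_T`. [folklore] -/
def enF : List Bool → List Bool := mzipF enItem ∘ fanoutFn yardF (fanoutFn nnF (fanoutFn (fun _ => []) (fanoutFn maskF finalF)))
/-- `Σ_E Nᵢⱼ² = ⟨E ⊙ N_T, N_T⟩`. [folklore] -/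
def qSF : List Bool → List Bool := frobF ∘ fanoutFn yardF (fanoutFn nnF (fanoutFn enF finalF))
/-- `τ²`. [folklore] -/
def tau2F : List Bool → List Bool := zmulF ∘ fanoutFn tauOF tauOF
/-- The numerator `8m(τ Σ Nᵢⱼ - M Σ_E Nᵢⱼ²) + 3τ²` (`outNum`). [folklore] -/
def numF : List Bool → List Bool :=
  zaddF ∘ fanoutFn
    (zmulF ∘ fanoutFn (zmulF ∘ fanoutFn (fun _ => dpEnc 8) (natToZF ∘ mmF))
      (zsubF ∘ fanoutFn (zmulF ∘ fanoutFn tauOF eSF) (zmulF ∘ fanoutFn (natToZF ∘ cMF) qSF)))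
    (zmulF ∘ fanoutFn (fun _ => dpEnc 3) tau2F)
/-- The denominator `8τ²`. [folklore] -/
def denF : List Bool → List Bool := zmulF ∘ fanoutFn (fun _ => dpEnc 8) tau2F
/-- The output integer `⌈outNum / 8τ²⌉ = -((-outNum)/(8τ²))` (`thetaZCap`). [folklore] -/
def zOutF : List Bool → List Bool := znegF ∘ zedivF ∘ fanoutFn (znegF ∘ numF) denF

/-- **The machine**: the numeral of `(thetaZCap W).toNat` (the first component of the canonical code).
[cite: GrotschelLovaszSchrijver1981, §6 (pp. 192–194)] -/
def thetaMachineF : List Bool → List Bool := fstF ∘ zOutF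

/-- `tauOF ∈ FP`. [folklore] -/
theorem tauOF_mem_FP : tauOF ∈ FP :=
  comp_mem_FP frobF_mem_FP (fanoutFn_mem_FP yardF_mem_FP (fanoutFn_mem_FP nnF_mem_FP (fanoutFn_mem_FP idF_mem_FP finalF_mem_FP)))
/-- `eSF ∈ FP`. [folklore] -/
theorem eSF_mem_FP : eSF ∈ FP :=
  comp_mem_FP frobF_mem_FP (fanoutFn_mem_FP yardF_mem_FP (fanoutFn_mem_FP nnF_mem_FP (fanoutFn_mem_FP onesMF_mem_FP finalF_mem_FP)))
/-- `enF ∈ FP`. [folklore] -/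
theorem enF_mem_FP : enF ∈ FP :=
  comp_mem_FP (mzipF_mem_FP enItem_mem_FP (w := 2) le_rfl length_enItem_le)
    (fanoutFn_mem_FP yardF_mem_FP (fanoutFn_mem_FP nnF_mem_FP (fanoutFn_mem_FP (const_mem_FP _) (fanoutFn_mem_FP maskF_mem_FP finalF_mem_FP))))
/-- `qSF ∈ FP`. [folklore] -/
theorem qSF_mem_FP : qSF ∈ FP :=
  comp_mem_FP frobF_mem_FP (fanoutFn_mem_FP yardF_mem_FP (fanoutFn_mem_FP nnF_mem_FP (fanoutFn_mem_FP enF_mem_FP finalF_mem_FP)))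
/-- `tau2F ∈ FP`. [folklore] -/
theorem tau2F_mem_FP : tau2F ∈ FP := comp_mem_FP zmulF_mem_FP (fanoutFn_mem_FP tauOF_mem_FP tauOF_mem_FP)
/-- `numF ∈ FP`. [folklore] -/
theorem numF_mem_FP : numF ∈ FP :=
  comp_mem_FP zaddF_mem_FP (fanoutFn_mem_FP
    (comp_mem_FP zmulF_mem_FP (fanoutFn_mem_FP (comp_mem_FP zmulF_mem_FP (fanoutFn_mem_FP (const_mem_FP _) (comp_mem_FP natToZF_mem_FP mmF_mem_FP)))
      (comp_mem_FP zsubF_mem_FP (fanoutFn_mem_FP (comp_mem_FP zmulF_mem_FP (fanoutFn_mem_FP tauOF_mem_FP eSF_mem_FP))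
        (comp_mem_FP zmulF_mem_FP (fanoutFn_mem_FP (comp_mem_FP natToZF_mem_FP cMF_mem_FP) qSF_mem_FP))))))
    (comp_mem_FP zmulF_mem_FP (fanoutFn_mem_FP (const_mem_FP _) tau2F_mem_FP)))
/-- `denF ∈ FP`. [folklore] -/
theorem denF_mem_FP : denF ∈ FP := comp_mem_FP zmulF_mem_FP (fanoutFn_mem_FP (const_mem_FP _) tau2F_mem_FP)
/-- `zOutF ∈ FP`. [folklore] -/
theorem zOutF_mem_FP : zOutF ∈ FP :=
  comp_mem_FP znegF_mem_FP (comp_mem_FP zedivF_mem_FP (fanoutFn_mem_FP (comp_mem_FP znegF_mem_FP numF_mem_FP) denF_mem_FP))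

/-- **`thetaMachineF ∈ FP`** (polynomial time, by composition of bricks). [cite: AroraBarak2009, §1.3 (polynomial time is closed under composition)] -/
theorem thetaMachineF_mem_FP : thetaMachineF ∈ FP := comp_mem_FP fstF_mem_FP zOutF_mem_FP

section Output

variable {m : ℕ} {H : SimpleGraph (Fin n)} [DecidableRel H.Adj]

/-- `⟨J, N⟩ = Σᵢⱼ Nᵢⱼ`. [folklore] -/
theorem sum_of_one_mul (N : Matrix (Fin n) (Fin n) ℤ) : ∑ i, ∑ t, (Matrix.of fun _ _ : Fin n => (1 : ℤ)) i t * N i t = eSumInt n N := by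
  simp [eSumInt]

/-- `⟨E ⊙ N, N⟩ = Σ_E Nᵢⱼ²`. [folklore] -/
theorem sum_eInd_mul_mul (N : Matrix (Fin n) (Fin n) ℤ) : ∑ i, ∑ t, eInd H i t * N i t * N i t = qSumInt n H N := by
  unfold qSumInt eInd
  refine Finset.sum_congr rfl fun i _ => Finset.sum_congr rfl fun t _ => ?_
  split_ifs <;> ring

/-- **`tauOF` on the input**: the trace of the final matrix. [folklore] -/
theorem tauOF_input (h : RunHyp m H) : tauOF (inputCode m H) = dpEnc (iterCap n m H (width (inputCode m H)) (cT n m)).trace := by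
  rw [tauOF, Function.comp_apply, fanoutFn_apply, fanoutFn_apply, fanoutFn_apply, yardF_apply, nnF_input, idF_input m H h.hn, finalF_input h,
    frobF_apply _ (by rw [length_ones_width]; exact h.hn), sum_one_mul_eq_trace]

/-- **`eSF` on the input**: `Σᵢⱼ Nᵢⱼ`. [folklore] -/
theorem eSF_input (h : RunHyp m H) : eSF (inputCode m H) = dpEnc (eSumInt n (iterCap n m H (width (inputCode m H)) (cT n m))) := by
  rw [eSF, Function.comp_apply, fanoutFn_apply, fanoutFn_apply, fanoutFn_apply, yardF_apply, nnF_input, onesMF_input m H h.hn, finalF_input h,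
    frobF_apply _ (by rw [length_ones_width]; exact h.hn), sum_of_one_mul]

/-- **`enF` on the input**: the edge-masked final matrix. [folklore] -/
theorem enF_input (h : RunHyp m H) :
    enF (inputCode m H) = matCode (fun i j => eInd H i j * iterCap n m H (width (inputCode m H)) (cT n m) i j) := by
  rw [enF, Function.comp_apply, fanoutFn_apply, fanoutFn_apply, fanoutFn_apply, fanoutFn_apply, yardF_apply, nnF_input, maskF_input m H h.hn h.hdec,
    finalF_input h, maskCode, matCode_eq_tabCode, mzipF_apply _ _ (by rw [length_ones_width]; exact h.hn), matCode_eq_tabCode]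
  refine congrArg tabCode (funext fun i => funext fun j => ?_)
  rw [enItem_apply]

/-- **`qSF` on the input**: `Σ_E Nᵢⱼ²`. [folklore] -/
theorem qSF_input (h : RunHyp m H) : qSF (inputCode m H) = dpEnc (qSumInt n H (iterCap n m H (width (inputCode m H)) (cT n m))) := by
  rw [qSF, Function.comp_apply, fanoutFn_apply, fanoutFn_apply, fanoutFn_apply, yardF_apply, nnF_input, enF_input h, finalF_input h,
    frobF_apply _ (by rw [length_ones_width]; exact h.hn), sum_eInd_mul_mul]

/-- **`numF` on the input**: `outNum` of the final matrix. [folklore] -/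
theorem numF_input (h : RunHyp m H) : numF (inputCode m H) = dpEnc (outNum n m H (iterCap n m H (width (inputCode m H)) (cT n m))) := by
  simp only [numF, tau2F, Function.comp_apply, fanoutFn_apply, tauOF_input h, eSF_input h, qSF_input h, mmF_input, cMF_input, natToZF_encodeNat,
    zmulF_boolPair, zsubF_boolPair, zaddF_boolPair, ival_dpEnc, outNum]
  congr 1; ring

/-- **`denF` on the input**: `8τ²`. [folklore] -/
theorem denF_input (h : RunHyp m H) : denF (inputCode m H) = dpEnc (8 * (iterCap n m H (width (inputCode m H)) (cT n m)).trace ^ 2) := by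
  simp only [denF, tau2F, Function.comp_apply, fanoutFn_apply, tauOF_input h, zmulF_boolPair, ival_dpEnc]
  congr 1; ring

/-- **`zOutF` on the input is `dpEnc (thetaZCap W)`.** [folklore] -/
theorem zOutF_input (h : RunHyp m H) : zOutF (inputCode m H) = dpEnc (thetaZCap n m H (width (inputCode m H))) := by
  rw [zOutF, Function.comp_apply, Function.comp_apply, fanoutFn_apply, Function.comp_apply, numF_input h, denF_input h]
  simp only [znegF_eq, ival_dpEnc, zedivF_dpEnc]
  rfl

/-- The first component of a canonical code is the numeral of the non-negative part. [folklore] -/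
theorem fstF_dpEnc (z : ℤ) : fstF (dpEnc z) = encodeNat z.toNat := by
  rw [dpEnc, fstF_boolPair]

/-- **The machine on the input of `(n, H, m)`**: the numeral of `(thetaZCap W).toNat`, `W = Q(|inp|)`, under the
side conditions `RunHyp`. [cite: GrotschelLovaszSchrijver1981, §6 (pp. 192–194)] [cite: Jaggi2011, Thm. 17 (chunk p0022)] -/
theorem thetaMachineF_input (h : RunHyp m H) :
    thetaMachineF (inputCode m H) = encodeNat (thetaZCap n m H (width (inputCode m H))).toNat := by
  rw [thetaMachineF, Function.comp_apply, zOutF_input h, fstF_dpEnc]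

end Output

end ThetaFWMachine

end Literature.Computability.Complexity

end
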